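import Mathlib.Analysis.Convex.Hull
import Mathlib.LinearAlgebra.AffineSpace.Independent
import Mathlib.LinearAlgebra.AffineSpace.AffineMap
import Mathlib.Topology.Homeomorph.Lemmas
import Mathlib.RingTheory.MvPolynomial.Tower
import Literature.NumberTheory.Transcendental.SemialgebraicMaps
import HarnessLib

/-!
# Barrier: the semi-algebraic Hauptvermutung — no global semi-algebraic map without scissors

Topic `Literature/Barriers/KontsevichZagierPeriods` (D-0021 barrier catalogue for the summit
`KontsevichZagierPeriods`; found with the Dehn-invariant obstruction in Cresson–Viu-Sos'
geometric reformulation of Conjecture 1, companion file `DehnInvariantObstruction.lean`).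

## What is printed

Cresson–Viu-Sos, after reducing the Kontsevich–Zagier conjecture to the PL-GKZ conjecture
("rational polyhedra scissors-congruences and rational polyhedra transformations"
[CressonViusos2022, Conj. 1.2]; "PL-GKZ for all `d ≥ d₀` ⟹ KZ" [CressonViusos2022, Thm. 3.2];
"we call rational polyhedra transformation to any PL-map between two rational polyhedra",
loc. cit. §3.2), single out the rôle of the dissection operation:

*"We exhibit again in this other approach how essential is the decomposition-on-domains (or the
scissors-congruence) operation in the different conjectures presented in this article. If one
removes the scissors-congruence operation, then the main idea to find a counterexample to the
PL-GKZ-conjecture is to construct two PL-manifolds in the arithmetic class which are homeomorphic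
but not PL-homeomorphic. However, as a straightforward consequence of the Hauptvermutung for
compact semi-algebraic sets [29, Cor. 4.3] proved by M. Shiota and M. Yokoi, one has the following
obstruction.* **Proposition 3.2.** *If a period admits two representations by polyhedra `P₁` and
`P₂` as in the PL-GKZ-conjecture such that `P₁` is homeomorphic to `P₂` but not PL-homeomorphic,
then there is no global (volume-preserving) semi-algebraic mapping between `P₁` and `P₂`.* The
above result is due to the fact that triangulations of compact semi-algebraic sets are unique up
to PL-homeomorphism. As a consequence, there is no global volume-preserving PL-mapping between the
above polyhedra. This follows also from Milnor, Kirby and Siebenmann's example [17, 24]."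
[CressonViusos2022, §3.2 (p. 336), Prop. 3.2]; [29] = M. Shiota, M. Yokoi, *Triangulations of
subanalytic sets and locally subanalytic manifolds*, Trans. AMS 286 (1984), Cor. 4.3; [24] =
J. Milnor, *Two complexes which are homeomorphic but combinatorially distinct*, Ann. Math. 74
(1961).

All (semi-)algebraic objects of [CressonViusos2022] have coefficients in `ℝ_alg` (loc. cit. §1),
i.e. are `ℚ`-semialgebraic in the sense of the tree (`Literature.IsSemialgebraic ℚ`,
`Literature.IsSemialgebraicMapOn ℚ`; see the design notes of
`Literature.NumberTheory.Transcendental.SemialgebraicMaps`).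

## What is vendored

* PL vocabulary on `ℝᵈ = Fin d → ℝ` (none of it is in Mathlib): geometric simplices
  (`IsSimplex`, rational ones `IsRationalSimplex`), compact polyhedra (`IsPolyhedron`,
  `IsRationalPolyhedron`), PL maps (`IsPLMapOn`: continuous, affine on the simplices of a finite
  cover), `PLHomeomorphic`, and semi-algebraic homeomorphy `SemialgHomeomorphic` over the tree's
  `IsSemialgebraicMapOn ℚ`. [folklore]
* `cressonViuSos_prop_3_2` (named fact, BARRIER block): Proposition 3.2 as printed, for rational
  polyhedra `P₁, P₂ ⊆ ℝᵈ`: homeomorphic but not PL-homeomorphic ⟹ not semi-algebraically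
  homeomorphic (in particular no global volume-preserving semi-algebraic map). Its mathematical
  content is the semi-algebraic Hauptvermutung [ShiotaYokoi1984, Cor. 4.3] (as cited in
  [CressonViusos2022, Prop. 3.2]); not provable from Mathlib today (no PL topology), triage XL.
* `SemialgHomeomorphicOver k` (semi-algebraic homeomorphy with coefficients in a subring `k` of `ℝ`;
  `SemialgHomeomorphic = SemialgHomeomorphicOver ℚ`, and `k`-semialgebraic ⟹ `ℝ`-semialgebraic,
  `SemialgHomeomorphicOver.real`, via the base change `isSemialgebraic_algebra_of_isSemialgebraic`).
  [folklore]
* `cressonViuSos_prop_3_2_of_hauptvermutung` (proved): the printed one-line proof of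
  Proposition 3.2 as an implication — *semi-algebraic Hauptvermutung ⟹ `cressonViuSos_prop_3_2`*,
  the antecedent being [Shiota1997, Cor. III.1.4] for 𝔛 = the semialgebraic sets, spelled out in this
  file's vocabulary (`IsPolyhedron`, `SemialgHomeomorphicOver ℝ`, `PLHomeomorphic`); the proof is:
  rational polyhedra are polyhedra, `ℚ`-semialgebraic maps are `ℝ`-semialgebraic, contraposition.
  [CressonViusos2022, Prop. 3.2 (proof, p. 336)]

## What is NOT here (and why)

* **The semi-algebraic Hauptvermutung is not vendored as a named fact** (D-0026 bad-split review,
  2026-08-15). *Two 𝔛-homeomorphic compact polyhedra in `ℝⁿ` are PL homeomorphic*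
  [Shiota1997, Cor. III.1.4] (𝔛 = the semialgebraic subsets of Euclidean spaces, "the smallest
  example of 𝔛"; an 𝔛-map is a continuous map between 𝔛-sets with 𝔛-graph, loc. cit. Introduction) —
  the result [ShiotaYokoi1984, Cor. 4.3] invoked by [CressonViusos2022, Prop. 3.2] — was for a while a
  `def SemialgebraicHauptvermutung : Prop` in this file, the single decomposition child of the barrier
  `cressonViuSos_prop_3_2`, with the barrier proved from it. The review merged it back into the
  barrier's own proof obligation and removed the `def`, for three reasons. (i) The cut was faithful
  (the Lean statement was reviewed against the printed corollary) but did not cut anything: the child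
  carried the barrier's entire mathematical content — the printed proof of Proposition 3.2 is the one
  line kept here as `cressonViuSos_prop_3_2_of_hauptvermutung` — so parent and child were one theorem
  counted twice. (ii) The child is theory-sized, not lemma-sized: the printed proof
  [Shiota1997, §III.1, proof of Cor. III.1.4] runs through `C^r` Whitney
  𝔛-stratifications of an 𝔛-homeomorphism (II.1.15), controlled `C^r` 𝔛-tube systems (II.5.1, II.6.9),
  strong isomorphisms (II.1.19), `C^r` 𝔛-triangulation approximations (II.6.10), existence of
  𝔛-triangulations (II.2.1) and the PL theorems III.1.1–III.1.2 proved in §III.2 with the Alexander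
  trick and uniqueness of `C^∞` triangulations (I.3.13); Mathlib has no PL topology, and of
  semialgebraic geometry the tree has the Tarski–Seidenberg projection theorem
  (`Literature.ModelTheory.ExponentialFields.tarski_seidenberg_holds`) and the semialgebraicity of
  simplices (`Literature.ModelTheory.ExponentialFields.isSemialgebraic_convexHull_of_affineIndependent`),
  nothing above. The only printed intermediate statements — the semialgebraic triangulation theorems —
  were reviewed separately and found not to cut the Hauptvermutung down to size either (see the module
  docstring of `Literature.ModelTheory.ExponentialFields.SemialgebraicTriangulation`, "What is NOT
  here"); decompositions do not recurse. (iii) Nothing is lost: the barrier stands as this file's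
  single catalogued named fact (D-0021: an established no-go result not formalizable today), and
  whoever discharges it proves exactly the antecedent of `cressonViuSos_prop_3_2_of_hauptvermutung`
  as a theorem and applies that reduction. Guidance for a prove-seat on `cressonViuSos_prop_3_2`:
  triage XL (a theory: real semialgebraic geometry up to triangulation, plus PL topology up to the
  Hauptvermutung arguments of [Shiota1997, Ch. III] or [ShiotaYokoi1984]); do not re-split it into
  the Hauptvermutung or the triangulation theorems.

## References

* [CressonViusos2022] J. Cresson, J. Viu-Sos, *On the equality of periods of Kontsevich–Zagier*,
  J. Théor. Nombres Bordeaux 34 (2022) 323–343: Conj. 1.2, §3.1 (Thm. 3.1 semi-algebraic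
  triangulation, Lemma 3.1), §3.2 (Prop. 3.1, Thm. 3.2, Prop. 3.2), §4.2 (Thm. 4.3, Lemma 4.1).
* [ShiotaYokoi1984] M. Shiota, M. Yokoi, *Triangulations of subanalytic sets and locally
  subanalytic manifolds*, Trans. Amer. Math. Soc. 286 (1984) 727–750, Cor. 4.3 (cited after
  [CressonViusos2022]; not read).
* [Shiota1997] M. Shiota, *Geometry of Subanalytic and Semialgebraic Sets*, Progress in Math. 150,
  Birkhäuser (1997): Introduction pp. viii–ix (axioms (i)–(iv) of 𝔛, 𝔛-maps, semialgebraic sets are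
  the smallest 𝔛), Ch. III "Hauptvermutung for polyhedra", Thm. III.1.1, Thm. III.1.2,
  Cor. III.1.4 (𝔛-Hauptvermutung) with its proof (read).
* [BochnakCosteRoy1998] J. Bochnak, M. Coste, M.-F. Roy, *Real Algebraic Geometry* (1998), §2.1
  (semialgebraic sets; base change of coefficients is immediate from Def. 2.1.4).
* [Milnor1961] J. Milnor, *Two complexes which are homeomorphic but combinatorially distinct*,
  Ann. of Math. 74 (1961) 575–590 (cited after [CressonViusos2022]; not read).
-/

noncomputable section

open Set

namespace Literature.Barriers.KontsevichZagierPeriods.PL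

variable {d d' : ℕ}

/-! ### PL vocabulary (the technique class and its alternatives) -/

/-- A *(geometric) simplex* in `ℝᵈ`: the convex hull of an affinely independent finite family of
points. [folklore] -/
def IsSimplex (σ : Set (Fin d → ℝ)) : Prop :=
  ∃ (k : ℕ) (v : Fin (k + 1) → (Fin d → ℝ)), AffineIndependent ℝ v ∧ σ = convexHull ℝ (range v)

/-- A *rational simplex*: a simplex spanned by points with rational coordinates.
[cite: CressonViusos2022, §3.1-§3.2  rational polyhedra] -/
def IsRationalSimplex (σ : Set (Fin d → ℝ)) : Prop :=
  ∃ (k : ℕ) (v : Fin (k + 1) → (Fin d → ℝ)), AffineIndependent ℝ v ∧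
    (∀ i j, ∃ q : ℚ, v i j = (q : ℝ)) ∧ σ = convexHull ℝ (range v)

/-- A rational simplex is a simplex. [folklore] -/
theorem IsRationalSimplex.isSimplex {σ : Set (Fin d → ℝ)} (h : IsRationalSimplex σ) :
    IsSimplex σ := by
  obtain ⟨k, v, hv, -, rfl⟩ := h
  exact ⟨k, v, hv, rfl⟩

/-- A *(compact Euclidean) polyhedron*: a finite union of simplices (the realisation `|K|` of a
finite collection of simplices). [cite: CressonViusos2022, §3.1] -/
def IsPolyhedron (P : Set (Fin d → ℝ)) : Prop :=
  ∃ (n : ℕ) (σ : Fin n → Set (Fin d → ℝ)), (∀ i, IsSimplex (σ i)) ∧ P = ⋃ i, σ i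

/-- A *rational polyhedron*: a finite union of rational simplices.
[cite: CressonViusos2022, §3.1 Lemma 3.1 and Conj. 1.2] -/
def IsRationalPolyhedron (P : Set (Fin d → ℝ)) : Prop :=
  ∃ (n : ℕ) (σ : Fin n → Set (Fin d → ℝ)), (∀ i, IsRationalSimplex (σ i)) ∧ P = ⋃ i, σ i

/-- A rational polyhedron is a polyhedron. [folklore] -/
theorem IsRationalPolyhedron.isPolyhedron {P : Set (Fin d → ℝ)} (h : IsRationalPolyhedron P) :
    IsPolyhedron P := by
  obtain ⟨n, σ, hσ, rfl⟩ := h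
  exact ⟨n, σ, fun i => (hσ i).isSimplex, rfl⟩

/-- A *piecewise-linear (PL) map* on `P`: continuous on `P` and affine on each simplex of some
finite cover of `P` by simplices ("rational polyhedra transformation = any PL-map between two
rational polyhedra"). [cite: CressonViusos2022, §3.2] -/
def IsPLMapOn (P : Set (Fin d → ℝ)) (f : (Fin d → ℝ) → (Fin d' → ℝ)) : Prop :=
  ContinuousOn f P ∧ ∃ (n : ℕ) (σ : Fin n → Set (Fin d → ℝ)), (∀ i, IsSimplex (σ i)) ∧
    P = ⋃ i, σ i ∧ ∀ i, ∃ A : (Fin d → ℝ) →ᵃ[ℝ] (Fin d' → ℝ), EqOn f A (σ i)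

/-- `P` and `Q` are *PL-homeomorphic*: there are mutually inverse PL maps `P → Q`, `Q → P`.
[cite: CressonViusos2022, §3.2 and Lemma 4.1] -/
def PLHomeomorphic (P : Set (Fin d → ℝ)) (Q : Set (Fin d' → ℝ)) : Prop :=
  ∃ (f : (Fin d → ℝ) → (Fin d' → ℝ)) (g : (Fin d' → ℝ) → (Fin d → ℝ)),
    MapsTo f P Q ∧ MapsTo g Q P ∧ (∀ x ∈ P, g (f x) = x) ∧ (∀ y ∈ Q, f (g y) = y) ∧
    IsPLMapOn P f ∧ IsPLMapOn Q g

/-- `P` and `Q` are *semi-algebraically homeomorphic* (coefficients in `ℝ_alg`, i.e.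
`ℚ`-semialgebraic graphs): there are mutually inverse maps `P → Q`, `Q → P`, continuous on `P`
resp. `Q`, with `ℚ`-semialgebraic graphs — a "global semi-algebraic mapping between `P₁` and
`P₂`". [cite: CressonViusos2022, Prop. 3.1 (2) and Prop. 3.2] -/
def SemialgHomeomorphic (P : Set (Fin d → ℝ)) (Q : Set (Fin d' → ℝ)) : Prop :=
  ∃ (f : (Fin d → ℝ) → (Fin d' → ℝ)) (g : (Fin d' → ℝ) → (Fin d → ℝ)),
    MapsTo f P Q ∧ MapsTo g Q P ∧ (∀ x ∈ P, g (f x) = x) ∧ (∀ y ∈ Q, f (g y) = y) ∧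
    ContinuousOn f P ∧ ContinuousOn g Q ∧
    Literature.NumberTheory.Transcendental.IsSemialgebraicMapOn ℚ P f ∧ Literature.NumberTheory.Transcendental.IsSemialgebraicMapOn ℚ Q g

/-- PL-homeomorphic polyhedra are homeomorphic (as subspaces). [folklore] -/
theorem PLHomeomorphic.nonempty_homeomorph {P : Set (Fin d → ℝ)} {Q : Set (Fin d' → ℝ)}
    (h : PLHomeomorphic P Q) : Nonempty (P ≃ₜ Q) := by
  obtain ⟨f, g, hf, hg, hgf, hfg, ⟨hfc, -⟩, ⟨hgc, -⟩⟩ := h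
  let e : P ≃ Q :=
    { toFun := hf.restrict f P Q
      invFun := hg.restrict g Q P
      left_inv := fun x => Subtype.ext (hgf x x.2)
      right_inv := fun y => Subtype.ext (hfg y y.2) }
  exact ⟨{ toEquiv := e
           continuous_toFun := hfc.mapsToRestrict hf
           continuous_invFun := hgc.mapsToRestrict hg }⟩

/-! ### The barrier (named fact) -/

/-- **Cresson–Viu-Sos, Proposition 3.2 (semi-algebraic Hauptvermutung obstruction).** If two
rational polyhedra `P₁, P₂ ⊆ ℝᵈ` (representing the same period with piecewise algebraic volume
forms, as in the PL-GKZ conjecture) are homeomorphic but not PL-homeomorphic, then there is no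
global semi-algebraic homeomorphism between them — in particular no global volume-preserving
semi-algebraic change of variables: triangulations of compact semi-algebraic sets are unique up
to PL-homeomorphism [cite: CressonViusos2022, Prop. 3.2] (semi-algebraic Hauptvermutung
[cite: ShiotaYokoi1984, Cor. 4.3], as cited there).

BARRIER (D-0021).
technique_class: one global semi-algebraic (volume-preserving) map between two representations, WITHOUT dissection — rule 2) of the KZ calculus alone (`Literature.NumberTheory.Transcendental.KZ.changeOfVariablesRel`) / the "rational polyhedra transformations" of the PL-GKZ conjecture with the scissors-congruence operation removed (Lean: `SemialgHomeomorphic`, `PLHomeomorphic`) [cite: CressonViusos2022, §3.2 (p. 336)].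
blocks: the scissors-free strengthening of the PL-GKZ conjecture [cite: CressonViusos2022, Conj. 1.2] (route to `KontsevichZagierPeriods` = `Literature.Periods.KZPeriodConjecture` via [cite: CressonViusos2022, Thm. 3.2]) for pairs of homeomorphic, non-PL-homeomorphic polyhedral representations; more generally every attempt to pass between two such representations by a single change of variables.
because: a semi-algebraic homeomorphism between compact polyhedra makes them PL-homeomorphic (semi-algebraic Hauptvermutung [cite: ShiotaYokoi1984, Cor. 4.3], "triangulations of compact semi-algebraic sets are unique up to PL-homeomorphism" [cite: CressonViusos2022, §3.2 (p. 336)]), while homeomorphic non-PL-homeomorphic compact polyhedra exist (Milnor; Kirby–Siebenmann) [cite: CressonViusos2022, §3.2 refs 17, 24].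
evasions_known: keep the dissection operation — with scissors congruences AND PL maps any two rational polyhedra of equal volume are related [cite: CressonViusos2022, Thm. 4.1]; restrict to convex polyhedra, any two of which are PL-homeomorphic [cite: CressonViusos2022, Lemma 4.1 and Thm. 4.4]; for PL-homeomorphic PL-manifolds with piecewise constant forms of equal volume a volume-preserving PL-homeomorphism exists (Kuperberg; Henriques–Pak) [cite: CressonViusos2022, Thm. 4.3].
scope_caveats: printed as an obstruction to counterexample-hunting/strategies for the scissors-free variant only — nobody proposes Conjecture 1 without rule 1); the hypothesis needs homeomorphic non-PL-homeomorphic polyhedra, which exist only in dimension ≥ 5 (not printed in the source; the examples cited there are Milnor's complexes and Kirby–Siebenmann manifolds), so in the dimensions of hand computations the statement is vacuous; [ShiotaYokoi1984] was not read for this file (cited after [cite: CressonViusos2022, Prop. 3.2]); the Lean fact is stated for rational polyhedra in a common `ℝᵈ` and for all semi-algebraic homeomorphisms (the printed "(volume-preserving)" is parenthetical).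
status: established ([cite: CressonViusos2022, Prop. 3.2] from [cite: ShiotaYokoi1984, Cor. 4.3]). -/
def cressonViuSos_prop_3_2 : Prop :=
  ∀ (d : ℕ) (P₁ P₂ : Set (Fin d → ℝ)), IsRationalPolyhedron P₁ → IsRationalPolyhedron P₂ →
    Nonempty (P₁ ≃ₜ P₂) → ¬ PLHomeomorphic P₁ P₂ → ¬ SemialgHomeomorphic P₁ P₂

/-- Reading of the fact as printed ("there is no global (volume-preserving) semi-algebraic
mapping"): under its hypotheses no pair of mutually inverse continuous `ℚ`-semialgebraic maps
`P₁ ⇄ P₂` exists, whatever their Jacobians. [cite: CressonViusos2022, Prop. 3.2] -/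
theorem cressonViuSos_prop_3_2.no_global_map (h : cressonViuSos_prop_3_2) {d : ℕ}
    {P₁ P₂ : Set (Fin d → ℝ)} (h₁ : IsRationalPolyhedron P₁) (h₂ : IsRationalPolyhedron P₂)
    (htop : Nonempty (P₁ ≃ₜ P₂)) (hPL : ¬ PLHomeomorphic P₁ P₂)
    (f g : (Fin d → ℝ) → (Fin d → ℝ)) (hf : MapsTo f P₁ P₂) (hg : MapsTo g P₂ P₁)
    (hgf : ∀ x ∈ P₁, g (f x) = x) (hfg : ∀ y ∈ P₂, f (g y) = y)
    (hfc : ContinuousOn f P₁) (hgc : ContinuousOn g P₂)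
    (hfs : Literature.NumberTheory.Transcendental.IsSemialgebraicMapOn ℚ P₁ f) (hgs : Literature.NumberTheory.Transcendental.IsSemialgebraicMapOn ℚ P₂ g) : False :=
  h d P₁ P₂ h₁ h₂ htop hPL ⟨f, g, hf, hg, hgf, hfg, hfc, hgc, hfs, hgs⟩

/-! ### Base change of coefficients and the semi-algebraic Hauptvermutung

The printed proof of Proposition 3.2 is one line: a global semi-algebraic homeomorphism between
the two polyhedra would make them PL-homeomorphic by the Hauptvermutung for compact
semi-algebraic sets [CressonViusos2022, p. 336]. We prove that reduction as an implication whose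
antecedent is the Hauptvermutung over `ℝ` as printed in [Shiota1997, Cor. III.1.4] (not vendored
as a named fact, see the module docstring, "What is NOT here"); the coefficients `ℝ_alg`/`ℚ` of
[CressonViusos2022] are handled by the (trivial) base change below. -/

section BaseChange

variable {k R : Type*} {ι : Type*} [CommRing k] [CommRing R] [LT R] [Algebra k R]

/-- **Base change of coefficients.** A `k`-semialgebraic subset of `R ^ ι` is `R`-semialgebraic:
every generator `{p = 0}`, `{p > 0}` with `p ∈ k[X]` is the corresponding set for the image of `p`
in `R[X]` (immediate from the definition [cite: BochnakCosteRoy1998, Def. 2.1.4]; recorded here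
because the maps of [CressonViusos2022] have coefficients in `ℝ_alg`, i.e. are `ℚ`-semialgebraic,
while the Hauptvermutung is printed for real semialgebraic maps). -/
theorem isSemialgebraic_algebra_of_isSemialgebraic {s : Set (ι → R)}
    (hs : Literature.ModelTheory.ExponentialFields.IsSemialgebraic k s) :
    Literature.ModelTheory.ExponentialFields.IsSemialgebraic R s := by
  induction hs using BooleanSubalgebra.closure_bot_sup_induction with
  | mem t ht =>
    rcases ht with ⟨p, rfl⟩ | ⟨p, rfl⟩
    · convert Literature.ModelTheory.ExponentialFields.isSemialgebraic_setOf_eval_eq_zero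
        (k := R) (R := R) (MvPolynomial.map (algebraMap k R) p) using 1
      ext x
      simp only [mem_setOf_eq, MvPolynomial.aeval_map_algebraMap]
    · convert Literature.ModelTheory.ExponentialFields.isSemialgebraic_setOf_eval_pos
        (k := R) (R := R) (MvPolynomial.map (algebraMap k R) p) using 1
      ext x
      simp only [mem_setOf_eq, MvPolynomial.aeval_map_algebraMap]
  | bot => exact Literature.ModelTheory.ExponentialFields.isSemialgebraic_empty
  | sup t _ u _ iht ihu => exact iht.union ihu
  | compl t _ iht => exact iht.compl

/-- Base change for maps: a `k`-semialgebraic map (graph `k`-semialgebraic) is `R`-semialgebraic.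
[cite: BochnakCosteRoy1998, Def. 2.2.5] -/
theorem isSemialgebraicMapOn_algebra_of_isSemialgebraicMapOn {m n : ℕ} {s : Set (Fin m → R)}
    {f : (Fin m → R) → (Fin n → R)}
    (hf : Literature.NumberTheory.Transcendental.IsSemialgebraicMapOn k s f) :
    Literature.NumberTheory.Transcendental.IsSemialgebraicMapOn R s f :=
  isSemialgebraic_algebra_of_isSemialgebraic hf

end BaseChange

/-- `P` and `Q` are *semi-algebraically homeomorphic with coefficients in `k`* (`k` a subring of
`ℝ`, e.g. `ℚ`, `ℝ_alg`, `ℝ`): there are mutually inverse maps `P → Q`, `Q → P`, continuous on `P`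
resp. `Q`, whose graphs over `P` resp. `Q` are `k`-semialgebraic. For `k = ℝ` this is
"`𝔛`-homeomorphic" for `𝔛` = the semialgebraic sets ("an `𝔛`-map is a continuous map between
`𝔛`-sets with `𝔛`-graph") [cite: Shiota1997, Introduction pp. viii–ix]; for `k = ℚ` it is
`SemialgHomeomorphic` (`semialgHomeomorphic_iff`). -/
def SemialgHomeomorphicOver (k : Type*) [CommRing k] [Algebra k ℝ] (P : Set (Fin d → ℝ))
    (Q : Set (Fin d' → ℝ)) : Prop :=
  ∃ (f : (Fin d → ℝ) → (Fin d' → ℝ)) (g : (Fin d' → ℝ) → (Fin d → ℝ)),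
    MapsTo f P Q ∧ MapsTo g Q P ∧ (∀ x ∈ P, g (f x) = x) ∧ (∀ y ∈ Q, f (g y) = y) ∧
    ContinuousOn f P ∧ ContinuousOn g Q ∧
    Literature.NumberTheory.Transcendental.IsSemialgebraicMapOn k P f ∧
    Literature.NumberTheory.Transcendental.IsSemialgebraicMapOn k Q g

/-- `SemialgHomeomorphic` is semi-algebraic homeomorphy with coefficients in `ℚ` (definitional).
[cite: CressonViusos2022, §1 and Prop. 3.2] -/
theorem semialgHomeomorphic_iff {P : Set (Fin d → ℝ)} {Q : Set (Fin d' → ℝ)} :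
    SemialgHomeomorphic P Q ↔ SemialgHomeomorphicOver ℚ P Q :=
  Iff.rfl

/-- Base change: semi-algebraically homeomorphic over `k` ⟹ semi-algebraically homeomorphic over
`ℝ` (same maps; their graphs are `ℝ`-semialgebraic by
`isSemialgebraic_algebra_of_isSemialgebraic`). [cite: BochnakCosteRoy1998, Def. 2.2.5] -/
theorem SemialgHomeomorphicOver.real {k : Type*} [CommRing k] [Algebra k ℝ] {P : Set (Fin d → ℝ)}
    {Q : Set (Fin d' → ℝ)} (h : SemialgHomeomorphicOver k P Q) : SemialgHomeomorphicOver ℝ P Q := by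
  obtain ⟨f, g, hf, hg, hgf, hfg, hfc, hgc, hfs, hgs⟩ := h
  exact ⟨f, g, hf, hg, hgf, hfg, hfc, hgc, isSemialgebraicMapOn_algebra_of_isSemialgebraicMapOn hfs,
    isSemialgebraicMapOn_algebra_of_isSemialgebraicMapOn hgs⟩

/-- Semi-algebraically homeomorphic sets (over any `k`) are homeomorphic as subspaces.
[folklore] -/
theorem SemialgHomeomorphicOver.nonempty_homeomorph {k : Type*} [CommRing k] [Algebra k ℝ]
    {P : Set (Fin d → ℝ)} {Q : Set (Fin d' → ℝ)} (h : SemialgHomeomorphicOver k P Q) :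
    Nonempty (P ≃ₜ Q) := by
  obtain ⟨f, g, hf, hg, hgf, hfg, hfc, hgc, -, -⟩ := h
  let e : P ≃ Q :=
    { toFun := hf.restrict f P Q
      invFun := hg.restrict g Q P
      left_inv := fun x => Subtype.ext (hgf x x.2)
      right_inv := fun y => Subtype.ext (hfg y y.2) }
  exact ⟨{ toEquiv := e
           continuous_toFun := hfc.mapsToRestrict hf
           continuous_invFun := hgc.mapsToRestrict hg }⟩

/-- **Proof of Proposition 3.2 from the semi-algebraic Hauptvermutung** (the printed argument,
[cite: CressonViusos2022, Prop. 3.2 (p. 336)]). The hypothesis `H` is the semi-algebraic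
Hauptvermutung (Shiota–Yokoi; Shiota) spelled out in this file's vocabulary: *two `𝔛`-homeomorphic
compact polyhedra in `ℝⁿ` are PL homeomorphic* [cite: Shiota1997, Cor. III.1.4], for `𝔛` = the
family of semialgebraic subsets of Euclidean spaces — "the smallest example of `𝔛`"; an `𝔛`-map is
a continuous map between `𝔛`-sets with `𝔛`-graph (loc. cit., Introduction) — i.e. the
"Hauptvermutung for compact semi-algebraic sets" [cite: ShiotaYokoi1984, Cor. 4.3] invoked at
loc. cit. ("triangulations of compact semialgebraic sets are unique up to PL-homeomorphism",
[cite: CressonViusos2022, §3.2 (p. 336)]). Lean reading of `H`: compact polyhedra = finite unions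
of simplices (`IsPolyhedron`), both in the same `ℝⁿ` as printed; `𝔛`-homeomorphic = mutually
inverse maps, continuous on the two sets, with `ℝ`-semialgebraic graphs
(`SemialgHomeomorphicOver ℝ`); PL homeomorphic = `PLHomeomorphic` (mutually inverse PL maps).
`H` is deliberately a hypothesis and not a named fact of the tree (module docstring, "What is NOT
here"): it is the entire mathematical content of the barrier and a theory-sized theorem
[cite: Shiota1997, §III.1 (Thm. III.1.1, Thm. III.1.2, proof of Cor. III.1.4)].

The printed proof: if the rational polyhedra `P₁, P₂ ⊆ ℝᵈ` were semi-algebraically homeomorphic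
(coefficients in `ℝ_alg`, i.e. `ℚ`-semialgebraic graphs), the same maps are `ℝ`-semialgebraic
(`SemialgHomeomorphicOver.real`), so by `H` the compact polyhedra `P₁, P₂` would be
PL-homeomorphic — contradiction. (The topological-homeomorphy hypothesis of the proposition is not
used.) Hence discharging the barrier (`cressonViuSos_prop_3_2_holds`) amounts exactly to proving
the antecedent `H` as a theorem. -/
theorem cressonViuSos_prop_3_2_of_hauptvermutung
    (H : ∀ (n : ℕ) (X Y : Set (Fin n → ℝ)), IsPolyhedron X → IsPolyhedron Y →
      SemialgHomeomorphicOver ℝ X Y → PLHomeomorphic X Y) :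
    cressonViuSos_prop_3_2 := by
  intro d P₁ P₂ h₁ h₂ _ hPL hSA
  exact hPL (H d P₁ P₂ h₁.isPolyhedron h₂.isPolyhedron
    (SemialgHomeomorphicOver.real (semialgHomeomorphic_iff.mp hSA)))

end Literature.Barriers.KontsevichZagierPeriods.PL
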